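/-
Copyright (c) 2026 the pub-hodgecm-mathlib formalisation cell (harness21).  Prover seat hodgecm-mathlib-LH10-p01 (g10): road M6 «ROW 2 ★ DYADIC TWIN» (LEAD F0P3a-plan T14-66),
dealer LH4-plan (g8) WORD #69∕#71 DEAL g8-#19b «F3-2a» (sheet LH7-p04 (g11) SIG-F3-2 1439c25edf82a388, PART A) = ★ [T2-a] `CyclicSelfDualLatticeTorsor` §2 (F0P3b-p01 (g12))
re-threaded from the monogenic order `𝒪[τ]` to an arbitrary over-order `O ≤ B`; 2026-09-02.
-/
import Literature.NumberTheory.Automorphic.CyclicSelfDualLatticeTorsor      -- ★ [T2-a] p846576: §1 Krylov∕cyclic-vector kit, §2 adjoint∕Gram lemmas; brings ★ `FixedCosetsStableLattices`, ★ L1 docking, ★ (c1) torsor count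
import HarnessLib

/-!
# Self-dual `O`-cyclic lattices of a regular element are a torsor under `C_O ∕ O^×`, for ANY over-order `O` (★ [T2-a] with `𝒪[τ] ↦ O`)

Topic `NumberTheory/Automorphic`; namespace `Literature.NumberTheory.Automorphic`.  THEOREMS ONLY (no definition, no instance, no notation, no named fact, no `sorry`); kernel lane
`--supports stmt-HodgeConjecture-24833`.  Cell `pub/hodgecm-mathlib` (D-0151), crux H413; road M6 «ROW 2 ★ DYADIC TWIN» (LEAD F0P3a-plan (g15) T14-66), F3 «TOT-Λ BY OVER-ORDERS»
(dealer LH4-plan (g8) WORD #69, route (B), gate F3-0 = FIT), brick **F3-2a** (sheet LH7-p04 (g11) SIG-F3-2 1439c25edf82a388 PART A; typing this seat).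
HONEST LABEL: HC_CM is proved only modulo the 7 printed citations (2 remaining named inputs: hLiu418 = stmt-HodgeConjecture-24832, h413 = stmt-HodgeConjecture-24833) until rung 0 closes;
elementary lattice algebra, asserts nothing printed, count-neutral (zero label movement until F5 ★ + a desk-priced rider).

THE MATHEMATICS = ★ [T2-a]'s frame VERBATIM (`E` with a `ValuativeRel`; `τ ∈ M_n(E)` with integral characteristic polynomial and a CYCLIC vector `w₀`; a commutative carrier
`B`, an injective `E`-algebra map `φ : B → M_n(E)` with `φ τ_B = τ`; `⋆ : B → B` intertwining the `J`-adjoint) EXCEPT that the ORDER is an arbitrary subring `O ≤ B` containing the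
scalars `𝒪[E]` (`hO`) — an OVER-ORDER of `𝒪[τ_B]`.  TOKEN (inline, no `def`): the `O`-cyclic lattice `Λ_O(w) := span_𝒪 {φ(b)·w : b ∈ O}` (for `O = 𝒪[τ_B]` it is [T2-a]'s
`⊕_{j<n} 𝒪·τ^j w`, §0); `O^× := O.toSubmonoid.units`, `C_O := O^×.comap (id · (⋆ on units))`.  §1: translation, `O^×`-stability, STABILISER (`φ(d)·Λ_O(w₀) = Λ_O(w₀) ⇒ d ∈ O^×`,
by cyclicity of `w₀` and injectivity of `φ`), cancellation, multiplier reading `{b : φ(b)·Λ_O(w₀) ≤ Λ_O(w₀)} = O`.  §2: good units, `C_O`-stability, transitivity, fibres,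
exhaustion and the COUNT **`#S_O = [C_O : O^×]`**, `S_O := {Λ | (∃ u ∈ U(σ,J), Λ = Λ(u)) ∧ ∃ w, Λ = Λ_O(w)}`, given one good `b₀` — ★ [T2-a]'s proofs with `L(w) ↦ Λ_O(w)`,
the Gram-matrix steps CALLED (★ L1 docking, ★ `exists_mem_glInt_coe_eq_formCongr`, ★ `formCongr_eq_mul_of_adjoint`, ★ `span_range_transpose_*`).  Left to F3-2b ∕ F3-3:
which `Λ` are `O`-cyclic for which `O` (★ (O4-G)), the value of `[C_O : O^×]`, the existence of a good `b₀`.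

* §0 `mem_span_image_mulVec_iff`, `span_image_mulVec_adjoin_singleton_eq_span_range_pow_mulVec` (dictionary with [T2-a]).
* §1 `span_image_mulVec_mulVec_eq_map`, `map_span_image_mulVec_eq_of_mem_units`, `mem_of_map_mulVec_mem_span_image`, `mem_units_of_map_span_image_eq`,
  `map_span_image_eq_self_of_map_span_image_mul_eq`, `setOf_map_le_span_image_eq`.
* §2 `good_mul_of_mem_comap_over`, `mul_inv_mem_comap_of_good_of_good_over`, `span_image_eq_span_image_iff_inv_mul_mem_units`, `exists_units_of_mem_over`,
  **`ncard_setOf_selfDual_cyclicOver_eq_relIndex`**, `setOf_selfDual_cyclicOver_eq_empty`.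

## References
* [Jacobowitz1962] R. Jacobowitz, *Hermitian forms over local fields*, Amer. J. Math. 84 (1962): §7 (unimodular lattices; lattices of a type as a units-torsor).
* [Serre1980Trees] J.-P. Serre, *Trees* (1980): Ch. II §1.1 (lattice classes counted by stabilisers).
* [Rogawski1990] J. D. Rogawski, *Automorphic Representations of Unitary Groups in Three Variables* (1990): §4.9 Lemma 4.9.3 p. 56 (orbital integrals as lattice counts).
* [HornJohnson2013] R. A. Horn, C. R. Johnson, *Matrix Analysis* (2nd ed. 2013): §3.2.4 (non-derogatory matrices: the commutant is `E[τ]`).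
-/

set_option autoImplicit false

noncomputable section

open Matrix Polynomial
open scoped MatrixGroups ValuativeRel

namespace Literature.NumberTheory.Automorphic

open Literature.NumberTheory.Automorphic.UnitaryGroup

section OverOrder

variable {E : Type*} [Field E] [ValuativeRel E] {n : ℕ} (σ : E →+* E)
  {B : Type*} [CommRing B] [Algebra E B]

variable (hσσ : ∀ x, σ (σ x) = x) (hσO : ∀ x : 𝒪[E], σ x ∈ 𝒪[E])
  (htr : ∃ b : 𝒪[E], (b : E) + σ b = 1) (hnorm : ∀ u : 𝒪[E], IsUnit u → σ u = u → ∃ t : 𝒪[E], (t : E) * σ t = u)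
  (J : GL (Fin n) E) (hJ : J ∈ glInt n E) (hJh : ((J : Matrix (Fin n) (Fin n) E).map σ)ᵀ = J)
  (τ : Matrix (Fin n) (Fin n) E) (hint : ∀ i, τ.charpoly.coeff i ∈ 𝒪[E]) {w₀ : Fin n → E}
  (hK : IsUnit (Matrix.of fun i j : Fin n => ((τ ^ (j : ℕ)) *ᵥ w₀) i).det)
  (φ : B →ₐ[E] Matrix (Fin n) (Fin n) E) (hφ : Function.Injective φ) (τB : B) (hτB : φ τB = τ)
  (star : B →+* B) (hstar : ∀ b, (J : Matrix (Fin n) (Fin n) E) * φ (star b) = ((φ b).map σ)ᵀ * J)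
  (O : Subring B) (hO : ∀ r : 𝒪[E], algebraMap E B (r : E) ∈ O)

/-! ## §0 The `O`-cyclic lattice `Λ_O(w) = span_𝒪 {φ(b) w : b ∈ O}`: membership, and the dictionary with [T2-a] -/

include hO in
/-- **Membership**: `Λ_O(w) = {φ(b)·w : b ∈ O}` — the image of `O` under `b ↦ φ(b) w` is already an `𝒪`-submodule (`O` is a ring containing `𝒪`), so its span adds nothing.
[cite: Serre1980Trees, Ch. II §1.1] -/
theorem mem_span_image_mulVec_iff (w x : Fin n → E) :
    x ∈ Submodule.span 𝒪[E] ((fun b : B => φ b *ᵥ w) '' (O : Set B)) ↔ ∃ b ∈ O, φ b *ᵥ w = x := by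
  constructor
  · intro hx
    induction hx using Submodule.span_induction with
    | mem y hy => exact hy
    | zero => exact ⟨0, O.zero_mem, by rw [map_zero, Matrix.zero_mulVec]⟩
    | add y z _ _ hy hz =>
      obtain ⟨b, hb, rfl⟩ := hy
      obtain ⟨b', hb', rfl⟩ := hz
      exact ⟨b + b', O.add_mem hb hb', by rw [map_add, Matrix.add_mulVec]⟩
    | smul r y _ hy =>
      obtain ⟨b, hb, rfl⟩ := hy
      refine ⟨algebraMap E B (r : E) * b, O.mul_mem (hO r) hb, ?_⟩
      rw [map_mul, AlgHom.commutes, ← Algebra.smul_def, Matrix.smul_mulVec]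
      rfl
  · rintro ⟨b, hb, rfl⟩
    exact Submodule.subset_span ⟨b, hb, rfl⟩

include hint in
/-- **Dictionary with ★ [T2-a]**: for the monogenic order `O = 𝒪[τ_B]` (any subring with `φ(O) = 𝒪[τ]`), `Λ_O(w)` IS the Krylov lattice `⊕_{j<n} 𝒪·τ^j w`
(`⊇`: `τ^j = φ(τ_B^j)`; `⊆`: `𝒪[τ]·L(w) ≤ L(w)`, ★ `map_span_range_pow_mulVec_le_of_mem_adjoin`, Cayley–Hamilton with integral coefficients).
[cite: HornJohnson2013, §3.2.4] [cite: Serre1980Trees, Ch. II §1.1] -/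
theorem span_image_mulVec_eq_span_range_pow_mulVec_of_adjoin (hRB : ∀ x, x ∈ Algebra.adjoin 𝒪[E] ({τ} : Set (Matrix (Fin n) (Fin n) E)) ↔ ∃ b ∈ O, φ b = x)
    (w : Fin n → E) :
    Submodule.span 𝒪[E] ((fun b : B => φ b *ᵥ w) '' (O : Set B)) = Submodule.span 𝒪[E] (Set.range fun j : Fin n => (τ ^ (j : ℕ)) *ᵥ w) := by
  apply le_antisymm
  · rw [Submodule.span_le]
    rintro _ ⟨b, hb, rfl⟩
    have hmem : φ b ∈ Algebra.adjoin 𝒪[E] ({τ} : Set (Matrix (Fin n) (Fin n) E)) := (hRB _).2 ⟨b, hb, rfl⟩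
    -- `w ∈ L(w)` and `𝒪[τ]·L(w) ≤ L(w)`
    have hw : w ∈ Submodule.span 𝒪[E] (Set.range fun j : Fin n => (τ ^ (j : ℕ)) *ᵥ w) := by
      rcases Nat.eq_zero_or_pos n with h0 | h0
      · subst h0
        have hw0 : w = 0 := funext fun i => Fin.elim0 i
        rw [hw0]; exact Submodule.zero_mem _
      · have h : (τ ^ ((⟨0, h0⟩ : Fin n) : ℕ)) *ᵥ w ∈ Submodule.span 𝒪[E] (Set.range fun j : Fin n => (τ ^ (j : ℕ)) *ᵥ w) :=
          Submodule.subset_span ⟨⟨0, h0⟩, rfl⟩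
        rwa [show ((⟨0, h0⟩ : Fin n) : ℕ) = 0 from rfl, pow_zero, Matrix.one_mulVec] at h
    exact map_span_range_pow_mulVec_le_of_mem_adjoin τ hint w hmem ⟨w, hw, rfl⟩
  · rw [Submodule.span_le]
    rintro _ ⟨j, rfl⟩
    have hmem : τ ^ (j : ℕ) ∈ Algebra.adjoin 𝒪[E] ({τ} : Set (Matrix (Fin n) (Fin n) E)) :=
      Subalgebra.pow_mem _ (Algebra.self_mem_adjoin_singleton 𝒪[E] τ) _
    obtain ⟨b, hb, hbτ⟩ := (hRB _).1 hmem
    exact Submodule.subset_span ⟨b, hb, by simp only [hbτ]⟩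

/-! ## §1 Translation, `O^×`-stability, the stabiliser, cancellation, the multiplier reading -/

/-- **Translation**: `Λ_O(φ(a) w) = φ(a)·Λ_O(w)` for every `a ∈ B` (`B` is commutative). [cite: Serre1980Trees, Ch. II §1.1] -/
theorem span_image_mulVec_mulVec_eq_map (a : B) (w : Fin n → E) :
    Submodule.span 𝒪[E] ((fun b : B => φ b *ᵥ (φ a *ᵥ w)) '' (O : Set B)) =
      (Submodule.span 𝒪[E] ((fun b : B => φ b *ᵥ w) '' (O : Set B))).map ((Matrix.toLin' (φ a)).restrictScalars 𝒪[E]) := by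
  rw [Submodule.map_span, Set.image_image]
  congr 1
  refine Set.image_congr fun b _ => ?_
  rw [LinearMap.coe_restrictScalars, Matrix.toLin'_apply, Matrix.mulVec_mulVec, Matrix.mulVec_mulVec, ← map_mul, ← map_mul, mul_comm]

include hO in
/-- **`O^×` stabilises `Λ_O(w)`**: `φ(ρ)·Λ_O(w) = Λ_O(w)` for `ρ ∈ O^×` (`ρO = O`). (= ★ [T2-a] `map_span_range_pow_mulVec_eq_of_mem_units` with `𝒪[τ] ↦ O`.)
[cite: Serre1980Trees, Ch. II §1.1] -/
theorem map_span_image_mulVec_eq_of_mem_units (ρ : Bˣ) (hρ : ρ ∈ O.toSubmonoid.units) (w : Fin n → E) :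
    (Submodule.span 𝒪[E] ((fun b : B => φ b *ᵥ w) '' (O : Set B))).map ((Matrix.toLin' (φ (ρ : B))).restrictScalars 𝒪[E]) =
      Submodule.span 𝒪[E] ((fun b : B => φ b *ᵥ w) '' (O : Set B)) := by
  rw [Submonoid.mem_units_iff] at hρ
  rw [← span_image_mulVec_mulVec_eq_map]
  apply le_antisymm
  · rw [Submodule.span_le]
    rintro _ ⟨b, hb, rfl⟩
    refine (mem_span_image_mulVec_iff φ O hO _ _).2 ⟨b * ρ, O.mul_mem hb hρ.1, ?_⟩
    show φ (b * ρ) *ᵥ w = φ b *ᵥ (φ (ρ : B) *ᵥ w)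
    rw [Matrix.mulVec_mulVec, ← map_mul]
  · rw [Submodule.span_le]
    rintro _ ⟨b, hb, rfl⟩
    refine (mem_span_image_mulVec_iff φ O hO _ _).2 ⟨b * ((ρ⁻¹ : Bˣ) : B), O.mul_mem hb hρ.2, ?_⟩
    show φ (b * ((ρ⁻¹ : Bˣ) : B)) *ᵥ (φ (ρ : B) *ᵥ w) = φ b *ᵥ w
    rw [Matrix.mulVec_mulVec, ← map_mul, mul_assoc, Units.inv_mul, mul_one]

include hK hφ hτB hO in
/-- **The multiplier reading at the cyclic vector**: `φ(x)·w₀ ∈ Λ_O(w₀) ⇒ x ∈ O` — `φ(x) w₀ = φ(b) w₀` with `b ∈ O` forces `φ(x − b) = 0` (cyclicity of `w₀`, ★ [T2-a]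
`eq_zero_of_commute_of_mulVec_eq_zero`), hence `x = b` (`φ` injective). [cite: HornJohnson2013, §3.2.4] -/
theorem mem_of_mulVec_mem_span_image (x : B) (hx : φ x *ᵥ w₀ ∈ Submodule.span 𝒪[E] ((fun b : B => φ b *ᵥ w₀) '' (O : Set B))) : x ∈ O := by
  obtain ⟨b, hb, hbx⟩ := (mem_span_image_mulVec_iff φ O hO _ _).1 hx
  have h0 : φ (x - b) *ᵥ w₀ = 0 := by rw [map_sub, Matrix.sub_mulVec, hbx, sub_self]
  have hφ0 : φ (x - b) = 0 := eq_zero_of_commute_of_mulVec_eq_zero τ (φ (x - b)) (commute_map_of_eq τ φ τB hτB _) hK h0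
  have hxb : x = b := sub_eq_zero.1 (hφ (by rw [hφ0, map_zero]))
  rw [hxb]; exact hb

include hK hφ hτB hO in
/-- **Stabiliser on units**: for `d : Bˣ`, `φ(d)·Λ_O(w₀) = Λ_O(w₀)` forces `d ∈ O^×` (both `φ(d) w₀` and `φ(d⁻¹) w₀` lie in `Λ_O(w₀)`). (= ★ [T2-a] `mem_units_of_map_span_eq`.)
[cite: Serre1980Trees, Ch. II §1.1] -/
theorem mem_units_of_map_span_image_eq (d : Bˣ)
    (hd : (Submodule.span 𝒪[E] ((fun b : B => φ b *ᵥ w₀) '' (O : Set B))).map ((Matrix.toLin' (φ (d : B))).restrictScalars 𝒪[E]) =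
      Submodule.span 𝒪[E] ((fun b : B => φ b *ᵥ w₀) '' (O : Set B))) :
    d ∈ O.toSubmonoid.units := by
  set Λ := Submodule.span 𝒪[E] ((fun b : B => φ b *ᵥ w₀) '' (O : Set B)) with hΛ
  have hw₀ : w₀ ∈ Λ := Submodule.subset_span ⟨1, O.one_mem, by simp only [map_one, Matrix.one_mulVec]⟩
  have hdinv : (Λ.map ((Matrix.toLin' (φ ((d⁻¹ : Bˣ) : B))).restrictScalars 𝒪[E])) = Λ := by
    have h := congrArg (Submodule.map ((Matrix.toLin' (φ ((d⁻¹ : Bˣ) : B))).restrictScalars 𝒪[E])) hd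
    rw [← Submodule.map_comp] at h
    have hcomp : ((Matrix.toLin' (φ ((d⁻¹ : Bˣ) : B))).restrictScalars 𝒪[E]).comp ((Matrix.toLin' (φ (d : B))).restrictScalars 𝒪[E]) = LinearMap.id := by
      apply LinearMap.ext; intro x
      simp only [LinearMap.coe_comp, Function.comp_apply, LinearMap.coe_restrictScalars, Matrix.toLin'_apply, Matrix.mulVec_mulVec, LinearMap.id_coe, id_eq]
      rw [← map_mul, Units.inv_mul, map_one, Matrix.one_mulVec]
    rw [hcomp, Submodule.map_id] at h
    exact h.symm
  have hmem : ∀ {e : Bˣ}, (Λ.map ((Matrix.toLin' (φ (e : B))).restrictScalars 𝒪[E])) = Λ → (e : B) ∈ O := by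
    intro e he
    refine mem_of_mulVec_mem_span_image τ hK φ hφ τB hτB O hO (e : B) ?_
    show φ (e : B) *ᵥ w₀ ∈ Λ
    rw [← he]
    exact ⟨w₀, hw₀, rfl⟩
  rw [Submonoid.mem_units_iff]
  exact ⟨hmem hd, hmem hdinv⟩

/-- **Cancellation**: if `φ(x)` fixes `Λ_O(φ(b) w₀) = φ(b)·Λ_O(w₀)` (`b ∈ Bˣ`) then it fixes `Λ_O(w₀)`. (= ★ [T2-a] `map_span_eq_self_of_map_span_mul_eq`.)
[cite: Serre1980Trees, Ch. II §1.1] -/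
theorem map_span_image_eq_self_of_map_span_image_mul_eq (b : Bˣ) (x : B)
    (h : (Submodule.span 𝒪[E] ((fun b' : B => φ b' *ᵥ (φ (b : B) *ᵥ w₀)) '' (O : Set B))).map ((Matrix.toLin' (φ x)).restrictScalars 𝒪[E]) =
      Submodule.span 𝒪[E] ((fun b' : B => φ b' *ᵥ (φ (b : B) *ᵥ w₀)) '' (O : Set B))) :
    (Submodule.span 𝒪[E] ((fun b' : B => φ b' *ᵥ w₀) '' (O : Set B))).map ((Matrix.toLin' (φ x)).restrictScalars 𝒪[E]) =
      Submodule.span 𝒪[E] ((fun b' : B => φ b' *ᵥ w₀) '' (O : Set B)) := by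
  set bu : GL (Fin n) E := Units.map (φ : B →* Matrix (Fin n) (Fin n) E) b with hbu
  have hbu_val : (bu : Matrix (Fin n) (Fin n) E) = φ (b : B) := by rw [hbu, Units.coe_map, MonoidHom.coe_coe]
  have hLb : Submodule.span 𝒪[E] ((fun b' : B => φ b' *ᵥ (φ (b : B) *ᵥ w₀)) '' (O : Set B)) =
      (Submodule.span 𝒪[E] ((fun b' : B => φ b' *ᵥ w₀) '' (O : Set B))).map ((Matrix.toLin' (bu : Matrix (Fin n) (Fin n) E)).restrictScalars 𝒪[E]) := by
    rw [hbu_val, span_image_mulVec_mulVec_eq_map]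
  have hcomm : ((Matrix.toLin' (φ x)).restrictScalars 𝒪[E]).comp ((Matrix.toLin' (bu : Matrix (Fin n) (Fin n) E)).restrictScalars 𝒪[E]) =
      ((Matrix.toLin' (bu : Matrix (Fin n) (Fin n) E)).restrictScalars 𝒪[E]).comp ((Matrix.toLin' (φ x)).restrictScalars 𝒪[E]) := by
    apply LinearMap.ext
    intro v
    simp only [LinearMap.coe_comp, Function.comp_apply, LinearMap.coe_restrictScalars, Matrix.toLin'_apply, Matrix.mulVec_mulVec, hbu_val, ← map_mul,
      mul_comm x (b : B)]
  rw [hLb, ← Submodule.map_comp, hcomm, Submodule.map_comp] at h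
  exact map_toLin'_injective bu h

include hK hφ hτB hO in
/-- **The multiplier ring of `Λ_O(w₀)` is exactly `O`**: `{x ∈ B : φ(x)·Λ_O(w₀) ≤ Λ_O(w₀)} = O` — the stratum reading of TOT-Λ by over-orders (each self-dual `O`-cyclic lattice
has exact multiplier ring `O`). [cite: Serre1980Trees, Ch. II §1.1] [cite: Jacobowitz1962, §7] -/
theorem setOf_map_le_span_image_eq :
    {x : B | (Submodule.span 𝒪[E] ((fun b : B => φ b *ᵥ w₀) '' (O : Set B))).map ((Matrix.toLin' (φ x)).restrictScalars 𝒪[E]) ≤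
      Submodule.span 𝒪[E] ((fun b : B => φ b *ᵥ w₀) '' (O : Set B))} = (O : Set B) := by
  ext x
  simp only [Set.mem_setOf_eq, SetLike.mem_coe]
  constructor
  · intro hx
    have hw₀ : w₀ ∈ Submodule.span 𝒪[E] ((fun b : B => φ b *ᵥ w₀) '' (O : Set B)) :=
      Submodule.subset_span ⟨1, O.one_mem, by simp only [map_one, Matrix.one_mulVec]⟩
    exact mem_of_mulVec_mem_span_image τ hK φ hφ τB hτB O hO x (hx ⟨w₀, hw₀, rfl⟩)
  · intro hx
    rw [← span_image_mulVec_mulVec_eq_map, Submodule.span_le]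
    rintro _ ⟨b, hb, rfl⟩
    exact (mem_span_image_mulVec_iff φ O hO _ _).2 ⟨b * x, O.mul_mem hb hx, by rw [map_mul, ← Matrix.mulVec_mulVec]⟩

/-! ## §2 Good units, `C_O`-stability, transitivity, fibres, exhaustion, the count -/

include hσσ hσO htr hnorm hJ hJh hstar hO in
/-- **`C_O`-STABILITY OF THE GOOD UNITS**: if `Λ_O(φ(b) w₀)` is self-dual and `c c⋆ ∈ O^×` then `Λ_O(φ(c b) w₀)` is self-dual — its Gram matrix in the frame `φ(c)·u` is
`J·(u⁻¹ ρ u)`, `ρ = φ(c c⋆)`, and `u⁻¹ρu ∈ GL_n(𝒪)` since `ρ` stabilises the `O`-module `Λ(u)` (★ L1 docking). (= ★ [T2-a] `good_mul_of_mem_comap`.)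
[cite: Jacobowitz1962, §7 Thm. 7.1] [cite: Serre1980Trees, Ch. II §1.1] -/
theorem good_mul_of_mem_comap_over (b c : Bˣ)
    (hb : ∃ u ∈ unitaryGroupOfForm σ (J : Matrix (Fin n) (Fin n) E),
      Submodule.span 𝒪[E] ((fun b' : B => φ b' *ᵥ (φ (b : B) *ᵥ w₀)) '' (O : Set B)) = Submodule.span 𝒪[E] (Set.range ((u : Matrix (Fin n) (Fin n) E))ᵀ))
    (hc : c ∈ (O.toSubmonoid.units).comap (MonoidHom.id Bˣ * (Units.map (star : B →+* B).toMonoidHom))) :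
    ∃ u ∈ unitaryGroupOfForm σ (J : Matrix (Fin n) (Fin n) E),
      Submodule.span 𝒪[E] ((fun b' : B => φ b' *ᵥ (φ ((c * b : Bˣ) : B) *ᵥ w₀)) '' (O : Set B)) = Submodule.span 𝒪[E] (Set.range ((u : Matrix (Fin n) (Fin n) E))ᵀ) := by
  obtain ⟨u, hu, huL'⟩ := hb
  have huL := huL'.symm
  rw [Subgroup.mem_comap] at hc
  set ρ : Bˣ := (MonoidHom.id Bˣ * (Units.map (star : B →+* B).toMonoidHom)) c with hρdef
  have hρval : (ρ : B) = c * star c := by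
    rw [hρdef, MonoidHom.mul_apply, MonoidHom.id_apply, Units.val_mul, Units.coe_map]; rfl
  set cu : GL (Fin n) E := Units.map (φ : B →* Matrix (Fin n) (Fin n) E) c with hcu
  set ρu : GL (Fin n) E := Units.map (φ : B →* Matrix (Fin n) (Fin n) E) ρ with hρu
  have hcu_val : (cu : Matrix (Fin n) (Fin n) E) = φ (c : B) := by rw [hcu, Units.coe_map, MonoidHom.coe_coe]
  have hρu_val : (ρu : Matrix (Fin n) (Fin n) E) = φ (ρ : B) := by rw [hρu, Units.coe_map, MonoidHom.coe_coe]
  -- the new lattice is `Λ(cu * u)`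
  have hnew : Submodule.span 𝒪[E] ((fun b' : B => φ b' *ᵥ (φ ((c * b : Bˣ) : B) *ᵥ w₀)) '' (O : Set B)) =
      Submodule.span 𝒪[E] (Set.range (((cu * u : GL (Fin n) E) : Matrix (Fin n) (Fin n) E))ᵀ) := by
    rw [Units.val_mul, map_mul, ← Matrix.mulVec_mulVec, span_image_mulVec_mulVec_eq_map, ← huL, Units.val_mul, span_range_transpose_mul, hcu_val]
  -- `ρ` stabilises `Λ(u) = Λ_O(φ b w₀)`, so `u⁻¹ ρu u ∈ GL_n(𝒪)`
  have hstab : Submodule.span 𝒪[E] (Set.range ((u : Matrix (Fin n) (Fin n) E))ᵀ) =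
      Submodule.span 𝒪[E] (Set.range (((ρu * u : GL (Fin n) E) : Matrix (Fin n) (Fin n) E))ᵀ) := by
    rw [Units.val_mul, span_range_transpose_mul, huL, hρu_val, map_span_image_mulVec_eq_of_mem_units φ O hO ρ hc]
  have hk : u⁻¹ * (ρu * u) ∈ glInt n E := (span_range_transpose_eq_iff u (ρu * u)).1 hstab
  -- the Gram matrix of `cu * u` is `J · u⁻¹ ρu u`
  have hgram : formCongr σ (cu * u) (J : Matrix (Fin n) (Fin n) E) = (((J * (u⁻¹ * (ρu * u)) : GL (Fin n) E)) : Matrix (Fin n) (Fin n) E) := by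
    rw [formCongr_mul_eq_formCongr_formCongr, hcu, formCongr_eq_mul_of_adjoint σ J φ star hstar c, mul_comm (star (c : B)) _, ← hρval, ← hρu_val,
      formCongr_mul_of_mem_unitary σ J hu]
    simp only [Units.val_mul, Matrix.mul_assoc]
  -- ★ L1 docking
  refine (exists_mem_unitary_span_eq_iff_selfDual σ J hσσ hσO htr hnorm hJ hJh _).2 ⟨cu * u, ⟨J * (u⁻¹ * (ρu * u)), mul_mem hJ hk, hgram.symm⟩, hnew⟩

include hσσ hσO htr hnorm hJ hJh hK hφ hτB hstar hO in
/-- **TRANSITIVITY: two good units differ by an element of `C_O`** — if `Λ_O(φ(b₀) w₀)` and `Λ_O(φ(b₁) w₀)` are both self-dual then `(b₁b₀⁻¹)(b₁b₀⁻¹)⋆ ∈ O^×`.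
(= ★ [T2-a] `mul_inv_mem_comap_of_good_of_good`, verbatim with `𝒪[τ] ↦ O`.) [cite: Jacobowitz1962, §7] [cite: Serre1980Trees, Ch. II §1.1] -/
theorem mul_inv_mem_comap_of_good_of_good_over (b₀ b₁ : Bˣ)
    (hb₀ : ∃ u ∈ unitaryGroupOfForm σ (J : Matrix (Fin n) (Fin n) E),
      Submodule.span 𝒪[E] ((fun b' : B => φ b' *ᵥ (φ (b₀ : B) *ᵥ w₀)) '' (O : Set B)) = Submodule.span 𝒪[E] (Set.range ((u : Matrix (Fin n) (Fin n) E))ᵀ))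
    (hb₁ : ∃ u ∈ unitaryGroupOfForm σ (J : Matrix (Fin n) (Fin n) E),
      Submodule.span 𝒪[E] ((fun b' : B => φ b' *ᵥ (φ (b₁ : B) *ᵥ w₀)) '' (O : Set B)) = Submodule.span 𝒪[E] (Set.range ((u : Matrix (Fin n) (Fin n) E))ᵀ)) :
    b₁ * b₀⁻¹ ∈ (O.toSubmonoid.units).comap (MonoidHom.id Bˣ * (Units.map (star : B →+* B).toMonoidHom)) := by
  obtain ⟨u₀, hu₀, hL₀⟩ := hb₀
  obtain ⟨u₁, hu₁, hL₁⟩ := hb₁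
  set c : Bˣ := b₁ * b₀⁻¹ with hcdef
  rw [Subgroup.mem_comap]
  set ρ : Bˣ := (MonoidHom.id Bˣ * (Units.map (star : B →+* B).toMonoidHom)) c with hρdef
  have hρval : (ρ : B) = c * star c := by
    rw [hρdef, MonoidHom.mul_apply, MonoidHom.id_apply, Units.val_mul, Units.coe_map]; rfl
  set cu : GL (Fin n) E := Units.map (φ : B →* Matrix (Fin n) (Fin n) E) c with hcu
  set ρu : GL (Fin n) E := Units.map (φ : B →* Matrix (Fin n) (Fin n) E) ρ with hρu
  have hcu_val : (cu : Matrix (Fin n) (Fin n) E) = φ (c : B) := by rw [hcu, Units.coe_map, MonoidHom.coe_coe]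
  have hρu_val : (ρu : Matrix (Fin n) (Fin n) E) = φ (ρ : B) := by rw [hρu, Units.coe_map, MonoidHom.coe_coe]
  -- `Λ(cu * u₀) = Λ(u₁)`
  have hb₁c : (b₁ : B) = c * b₀ := by rw [hcdef, Units.val_mul, Units.inv_mul_cancel_right]
  have hΛ : Submodule.span 𝒪[E] (Set.range (((cu * u₀ : GL (Fin n) E) : Matrix (Fin n) (Fin n) E))ᵀ) =
      Submodule.span 𝒪[E] (Set.range ((u₁ : Matrix (Fin n) (Fin n) E))ᵀ) := by
    rw [Units.val_mul, span_range_transpose_mul, hcu_val, ← hL₀, ← span_image_mulVec_mulVec_eq_map, ← hL₁, hb₁c, map_mul, ← Matrix.mulVec_mulVec]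
  -- the Gram matrix of `cu * u₀` is unimodular (★ docking at `Λ(u₁)`), and equals `J · u₀⁻¹ ρu u₀`
  obtain ⟨g, ⟨J', hJ', hJ'g⟩, hΛg⟩ := (exists_mem_unitary_span_eq_iff_selfDual σ J hσσ hσO htr hnorm hJ hJh _).1 ⟨u₁, hu₁, rfl⟩
  have hk : (cu * u₀)⁻¹ * g ∈ glInt n E := (span_range_transpose_eq_iff (cu * u₀) g).1 (hΛ.trans hΛg)
  obtain ⟨J'', hJ'', hJ''e⟩ := exists_mem_glInt_coe_eq_formCongr σ hσO J' hJ' ((cu * u₀)⁻¹ * g)⁻¹ (inv_mem hk)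
  have hgram : formCongr σ (cu * u₀) (J : Matrix (Fin n) (Fin n) E) = (((J * (u₀⁻¹ * (ρu * u₀)) : GL (Fin n) E)) : Matrix (Fin n) (Fin n) E) := by
    rw [formCongr_mul_eq_formCongr_formCongr, hcu, formCongr_eq_mul_of_adjoint σ J φ star hstar c, mul_comm (star (c : B)) _, ← hρval, ← hρu_val,
      formCongr_mul_of_mem_unitary σ J hu₀]
    simp only [Units.val_mul, Matrix.mul_assoc]
  have hgram' : formCongr σ (cu * u₀) (J : Matrix (Fin n) (Fin n) E) = (J'' : Matrix (Fin n) (Fin n) E) := by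
    rw [hJ''e, hJ'g, ← formCongr_mul_eq_formCongr_formCongr, _root_.mul_inv_rev, inv_inv, mul_inv_cancel_left]
  have hX : J * (u₀⁻¹ * (ρu * u₀)) = J'' := Units.ext (hgram.symm.trans hgram')
  have hXint : u₀⁻¹ * (ρu * u₀) ∈ glInt n E := by
    have h : J⁻¹ * J'' ∈ glInt n E := mul_mem (inv_mem hJ) hJ''
    rwa [← hX, inv_mul_cancel_left] at h
  -- so `ρ` stabilises `Λ(u₀) = Λ_O(φ b₀ w₀)`, hence `Λ_O(w₀)`
  have hstabΛ : Submodule.span 𝒪[E] (Set.range ((u₀ : Matrix (Fin n) (Fin n) E))ᵀ) =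
      Submodule.span 𝒪[E] (Set.range (((ρu * u₀ : GL (Fin n) E) : Matrix (Fin n) (Fin n) E))ᵀ) := (span_range_transpose_eq_iff u₀ (ρu * u₀)).2 hXint
  have hstab₀ : (Submodule.span 𝒪[E] ((fun b' : B => φ b' *ᵥ (φ (b₀ : B) *ᵥ w₀)) '' (O : Set B))).map
      ((Matrix.toLin' (φ (ρ : B))).restrictScalars 𝒪[E]) = Submodule.span 𝒪[E] ((fun b' : B => φ b' *ᵥ (φ (b₀ : B) *ᵥ w₀)) '' (O : Set B)) := by
    rw [hL₀, ← hρu_val, ← span_range_transpose_mul, ← Units.val_mul]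
    exact hstabΛ.symm
  exact mem_units_of_map_span_image_eq τ hK φ hφ τB hτB O hO ρ (map_span_image_eq_self_of_map_span_image_mul_eq φ O b₀ (ρ : B) hstab₀)

include hK hφ hτB hO in
/-- **FIBRES**: `Λ_O(φ(c b₀) w₀) = Λ_O(φ(c′ b₀) w₀) ⟺ c⁻¹c′ ∈ O^×` (the stabiliser of `Λ_O(w₀)` on units is `O^×`). (= ★ [T2-a] `span_eq_span_iff_inv_mul_mem_units`.)
[cite: Serre1980Trees, Ch. II §1.1] -/
theorem span_image_eq_span_image_iff_inv_mul_mem_units (b₀ c c' : Bˣ) :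
    Submodule.span 𝒪[E] ((fun b' : B => φ b' *ᵥ (φ ((c * b₀ : Bˣ) : B) *ᵥ w₀)) '' (O : Set B)) =
        Submodule.span 𝒪[E] ((fun b' : B => φ b' *ᵥ (φ ((c' * b₀ : Bˣ) : B) *ᵥ w₀)) '' (O : Set B)) ↔
      c⁻¹ * c' ∈ O.toSubmonoid.units := by
  set d : Bˣ := c⁻¹ * c' with hd
  have he' : c' * b₀ = d * (c * b₀) := by rw [hd, mul_mul_mul_comm, inv_mul_cancel, one_mul]
  have key : Submodule.span 𝒪[E] ((fun b' : B => φ b' *ᵥ (φ ((c' * b₀ : Bˣ) : B) *ᵥ w₀)) '' (O : Set B)) =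
      (Submodule.span 𝒪[E] ((fun b' : B => φ b' *ᵥ (φ ((c * b₀ : Bˣ) : B) *ᵥ w₀)) '' (O : Set B))).map
        ((Matrix.toLin' (φ (d : B))).restrictScalars 𝒪[E]) := by
    rw [he', Units.val_mul, map_mul, ← Matrix.mulVec_mulVec, span_image_mulVec_mulVec_eq_map]
  constructor
  · intro h
    have h2 : (Submodule.span 𝒪[E] ((fun b' : B => φ b' *ᵥ (φ ((c * b₀ : Bˣ) : B) *ᵥ w₀)) '' (O : Set B))).map
        ((Matrix.toLin' (φ (d : B))).restrictScalars 𝒪[E]) =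
        Submodule.span 𝒪[E] ((fun b' : B => φ b' *ᵥ (φ ((c * b₀ : Bˣ) : B) *ᵥ w₀)) '' (O : Set B)) := by
      rw [← key]; exact h.symm
    exact mem_units_of_map_span_image_eq τ hK φ hφ τB hτB O hO d (map_span_image_eq_self_of_map_span_image_mul_eq φ O (c * b₀) (d : B) h2)
  · intro hd'
    rw [key]
    exact (map_span_image_mulVec_eq_of_mem_units φ O hO d hd' _).symm

include hK hφ hτB hO in
/-- **EVERY MEMBER OF THE SET IS `Λ_O(φ(b) w₀)` FOR A GOOD UNIT `b`**: a self-dual `Λ(u) = Λ_O(w)` is a full lattice; writing `w = r w₀` (`r = Σ c_j τ^j = φ(Σ c_j τ_B^j)`, ★ cyclic-vector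
torsor) the columns of `u` are `r·(φ(b_j) w₀)`, so `det u = det r · det V` forces `r` invertible, `r⁻¹ ∈ E[r] ⊆ φ(B)`, and `Σ c_j τ_B^j ∈ Bˣ` (`φ` injective).  (= ★ [T2-a]
`exists_units_of_mem`, with the full-rank step adapted to `Λ_O`.) [cite: Serre1980Trees, Ch. II §1.1] [cite: HornJohnson2013, §3.2.4] -/
theorem exists_units_of_mem_over {Λ : Submodule 𝒪[E] (Fin n → E)}
    (hΛ : (∃ u ∈ unitaryGroupOfForm σ (J : Matrix (Fin n) (Fin n) E), Λ = Submodule.span 𝒪[E] (Set.range ((u : Matrix (Fin n) (Fin n) E))ᵀ)) ∧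
      ∃ w : Fin n → E, Λ = Submodule.span 𝒪[E] ((fun b : B => φ b *ᵥ w) '' (O : Set B))) :
    ∃ b : Bˣ, (∃ u ∈ unitaryGroupOfForm σ (J : Matrix (Fin n) (Fin n) E),
        Submodule.span 𝒪[E] ((fun b' : B => φ b' *ᵥ (φ (b : B) *ᵥ w₀)) '' (O : Set B)) = Submodule.span 𝒪[E] (Set.range ((u : Matrix (Fin n) (Fin n) E))ᵀ)) ∧
      Λ = Submodule.span 𝒪[E] ((fun b' : B => φ b' *ᵥ (φ (b : B) *ᵥ w₀)) '' (O : Set B)) := by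
  classical
  obtain ⟨⟨u, hu, huΛ⟩, w, hw⟩ := hΛ
  -- `w = r w₀`, `r = Σ c_j τ^j = φ (Σ c_j τ_B^j)`
  obtain ⟨cf, hcf⟩ := exists_sum_smul_pow_mulVec_eq τ hK w
  set r : Matrix (Fin n) (Fin n) E := ∑ j : Fin n, cf j • τ ^ (j : ℕ) with hr
  set br : B := ∑ j : Fin n, cf j • τB ^ (j : ℕ) with hbr
  have hφbr : φ br = r := by
    rw [hbr, map_sum]
    exact Finset.sum_congr rfl fun j _ => by rw [map_smul, map_pow, hτB]
  -- the columns of `u` lie in `Λ_O(w)`: `u_j = φ(b_j) w = r · φ(b_j) w₀`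
  have hcol : ∀ j : Fin n, ∃ bj ∈ O, φ bj *ᵥ w = (u : Matrix (Fin n) (Fin n) E)ᵀ j := fun j =>
    (mem_span_image_mulVec_iff φ O hO w _).1 (by rw [← hw, huΛ]; exact Submodule.subset_span ⟨j, rfl⟩)
  choose bcol hbcolO hbcol using hcol
  set V : Matrix (Fin n) (Fin n) E := Matrix.of fun i j => (φ (bcol j) *ᵥ w₀) i with hV
  have huV : (u : Matrix (Fin n) (Fin n) E) = r * V := by
    ext i j
    have hj : (u : Matrix (Fin n) (Fin n) E) i j = (φ (bcol j) *ᵥ w) i := by rw [hbcol j]; rfl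
    rw [hj, ← hcf, ← hφbr, Matrix.mulVec_mulVec, ← map_mul, mul_comm, map_mul, ← Matrix.mulVec_mulVec, hφbr, Matrix.mul_apply, Matrix.mulVec, dotProduct]
    rfl
  -- `r` is invertible: `det u = det r · det V`
  have hru : IsUnit r.det := by
    have hdet : (u : Matrix (Fin n) (Fin n) E).det = r.det * V.det := by rw [huV, Matrix.det_mul]
    have huu : IsUnit (u : Matrix (Fin n) (Fin n) E).det := (Matrix.isUnits_det_units u)
    exact isUnit_of_mul_isUnit_left (hdet ▸ huu)
  -- `r⁻¹ ∈ E[r] = φ(E[br])`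
  have hinv : r⁻¹ ∈ (Algebra.adjoin E ({br} : Set B)).map φ := by
    rw [AlgHom.map_adjoin_singleton, hφbr]
    exact nonsing_inv_mem_adjoin r hru
  obtain ⟨b', -, hb'⟩ := Subalgebra.mem_map.1 hinv
  have hunit : br * b' = 1 := hφ (by rw [map_mul, hφbr, hb', map_one, Matrix.mul_nonsing_inv _ hru])
  refine ⟨Units.mkOfMulEqOne br b' hunit, ⟨u, hu, ?_⟩, ?_⟩
  · rw [Units.val_mkOfMulEqOne, hφbr, hcf, ← hw, huΛ]
  · rw [Units.val_mkOfMulEqOne, hφbr, hcf, ← hw]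

include hσσ hσO htr hnorm hJ hJh hK hφ hτB hstar hO in
/-- **THE OVER-ORDER TORSOR COUNT `[C_O : O^×]`** (F3-2a): if SOME `b₀ ∈ Bˣ` is good (`Λ_O(φ(b₀) w₀)` self-dual), then the self-dual `O`-CYCLIC lattices
`S_O = {Λ | (∃ u ∈ U(σ,J), Λ = Λ(u)) ∧ ∃ w, Λ = Λ_O(w)}` number `O^×.relIndex C_O`, `C_O = {c ∈ Bˣ : c c⋆ ∈ O^×}` — ★ (c1) `natCard_range_eq_relIndex_of_fibres` on
`c ↦ Λ_O(φ(c b₀) w₀)`.  (= ★ [T2-a] `ncard_setOf_selfDual_cyclic_eq_relIndex` with the Krylov lattice `⊕ 𝒪 τ^j w` replaced by `Λ_O(w)`, i.e. `𝒪[τ] ↦ O`.)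
[cite: Jacobowitz1962, §7] [cite: Serre1980Trees, Ch. II §1.1] [cite: Rogawski1990, §4.9 Lemma 4.9.3 p. 56] -/
theorem ncard_setOf_selfDual_cyclicOver_eq_relIndex (b₀ : Bˣ)
    (hb₀ : ∃ u ∈ unitaryGroupOfForm σ (J : Matrix (Fin n) (Fin n) E),
      Submodule.span 𝒪[E] ((fun b' : B => φ b' *ᵥ (φ (b₀ : B) *ᵥ w₀)) '' (O : Set B)) = Submodule.span 𝒪[E] (Set.range ((u : Matrix (Fin n) (Fin n) E))ᵀ)) :
    {Λ : Submodule 𝒪[E] (Fin n → E) |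
        (∃ u ∈ unitaryGroupOfForm σ (J : Matrix (Fin n) (Fin n) E), Λ = Submodule.span 𝒪[E] (Set.range ((u : Matrix (Fin n) (Fin n) E))ᵀ)) ∧
          ∃ w : Fin n → E, Λ = Submodule.span 𝒪[E] ((fun b : B => φ b *ᵥ w) '' (O : Set B))}.ncard =
      (O.toSubmonoid.units).relIndex ((O.toSubmonoid.units).comap (MonoidHom.id Bˣ * (Units.map (star : B →+* B).toMonoidHom))) := by
  set C : Subgroup Bˣ := (O.toSubmonoid.units).comap (MonoidHom.id Bˣ * (Units.map (star : B →+* B).toMonoidHom)) with hC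
  let f : C → Submodule 𝒪[E] (Fin n → E) := fun c =>
    Submodule.span 𝒪[E] ((fun b' : B => φ b' *ᵥ (φ (((c : Bˣ) * b₀ : Bˣ) : B) *ᵥ w₀)) '' (O : Set B))
  have hS : {Λ : Submodule 𝒪[E] (Fin n → E) |
        (∃ u ∈ unitaryGroupOfForm σ (J : Matrix (Fin n) (Fin n) E), Λ = Submodule.span 𝒪[E] (Set.range ((u : Matrix (Fin n) (Fin n) E))ᵀ)) ∧
          ∃ w : Fin n → E, Λ = Submodule.span 𝒪[E] ((fun b : B => φ b *ᵥ w) '' (O : Set B))} = Set.range f := by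
    ext Λ
    constructor
    · intro hΛ
      obtain ⟨b, hbgood, rfl⟩ := exists_units_of_mem_over σ J τ hK φ hφ τB hτB O hO hΛ
      have hc : b * b₀⁻¹ ∈ C :=
        mul_inv_mem_comap_of_good_of_good_over σ hσσ hσO htr hnorm J hJ hJh τ hK φ hφ τB hτB star hstar O hO b₀ b hb₀ hbgood
      refine ⟨⟨b * b₀⁻¹, hc⟩, ?_⟩
      show Submodule.span 𝒪[E] ((fun b' : B => φ b' *ᵥ (φ (((b * b₀⁻¹) * b₀ : Bˣ) : B) *ᵥ w₀)) '' (O : Set B)) = _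
      rw [inv_mul_cancel_right]
    · rintro ⟨c, rfl⟩
      obtain ⟨u, hu, h⟩ := good_mul_of_mem_comap_over σ hσσ hσO htr hnorm J hJ hJh φ star hstar O hO b₀ (c : Bˣ) hb₀ c.2
      exact ⟨⟨u, hu, h⟩, _, rfl⟩
  rw [hS, ← Nat.card_coe_set_eq]
  exact Literature.GroupTheory.natCard_range_eq_relIndex_of_fibres C (O.toSubmonoid.units) f fun c c' =>
    span_image_eq_span_image_iff_inv_mul_mem_units τ hK φ hφ τB hτB O hO b₀ (c : Bˣ) (c' : Bˣ)

include hK hφ hτB hO in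
/-- **NO GOOD UNIT ⇒ THE STRATUM IS EMPTY** (contrapositive of exhaustion): if no `b ∈ Bˣ` has `Λ_O(φ(b) w₀)` self-dual, then `S_O = ∅`. [cite: Serre1980Trees, Ch. II §1.1] -/
theorem setOf_selfDual_cyclicOver_eq_empty
    (hno : ∀ b : Bˣ, ¬ ∃ u ∈ unitaryGroupOfForm σ (J : Matrix (Fin n) (Fin n) E),
      Submodule.span 𝒪[E] ((fun b' : B => φ b' *ᵥ (φ (b : B) *ᵥ w₀)) '' (O : Set B)) = Submodule.span 𝒪[E] (Set.range ((u : Matrix (Fin n) (Fin n) E))ᵀ)) :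
    {Λ : Submodule 𝒪[E] (Fin n → E) |
        (∃ u ∈ unitaryGroupOfForm σ (J : Matrix (Fin n) (Fin n) E), Λ = Submodule.span 𝒪[E] (Set.range ((u : Matrix (Fin n) (Fin n) E))ᵀ)) ∧
          ∃ w : Fin n → E, Λ = Submodule.span 𝒪[E] ((fun b : B => φ b *ᵥ w) '' (O : Set B))} = ∅ := by
  ext Λ
  simp only [Set.mem_setOf_eq, Set.mem_empty_iff_false, iff_false]
  intro hΛ
  obtain ⟨b, hbgood, -⟩ := exists_units_of_mem_over σ J τ hK φ hφ τB hτB O hO hΛ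
  exact hno b hbgood

end OverOrder

end Literature.NumberTheory.Automorphic

end
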